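import Mathlib
import Summits.ValiantsHypothesis.ValiantsHypothesis.Theorems.BarrierLeverPartitionMinorsHitByVPHiddenStatesTropicalCertificates
import Summits.ValiantsHypothesis.ValiantsHypothesis.Theorems.BarrierLeverPartitionMinorsHitByVPHiddenStatesQstarCubeRefutation
import Summits.ValiantsHypothesis.ValiantsHypothesis.Theorems.BarrierLeverPartitionMinorsHitByVPHiddenStatesFullJoinUniversal
import Summits.ValiantsHypothesis.ValiantsHypothesis.Theorems.BarrierLeverPartitionMinorsHitByVPHiddenStatesLowerToAll

/-!
# Route BarrierLever — item `PartitionMinorsHitByVP` (stmt-ValiantsHypothesis-19717), line `hidden_states`: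
# THE CONJECTURES TC(Kf) AND PH(Kf) ARE FALSE FOR EVERY POLYNOMIAL STATE BUDGET `h ≤ Kf h ≤ h⁴`

Helper file (`--supports stmt-ValiantsHypothesis-19717`; cell valiant-natproofs, rung V4, 𝒟-side door (c), line
`Cruxes/PartitionMinorsHitByVP/Lines/hidden_states.lean` v9; prover seat val-np-p3 gen 19). Definition-free; closes NO item —
it REFUTES, by name, the two typed by-name conjectures at the head of the line's «conjecture column of record»
(card v9z: PH ⇒ TC ⇒ UTD-flat ⇒ UTD ⇒ node #1 ⇒ item).

THE OBSERVATION. `Tropical.Stmt.tropicalCertificates Kf` (p694641) says: eventually in `h`, EVERY injective row family `u` of every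
size `r ≤ 2^h` is certified against the ball–colex (flat) design on `Kf h` states; a certified family is `BallGood h (Kf h) r u`
(`Tropical.ballGood_of_certified`). But val-np-p4 g15's kernel theorem `FiveRank.not_ballGood_pow_four_hypothesis` (p577137) says that
for NO `h₁`, `Kf` with `h ≤ Kf h ≤ h⁴` (`h ≥ h₁`) is every injective family `BallGood h (Kf h) r`: for `h ≥ 10¹⁰` and every
`K ∈ [h, h⁴]` the `r = K + 1 + 18(n+1)⁴` distinct 5-subsets of the first `n = min h (⌊√((K−1)/6)⌋ − 1)` coordinates defeat the flat
design on `K` states (five-row rank bound). That witness lives at `r ≈ K + 18h⁴` — INSIDE the «hybrid» range `r > h³ + 1` for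
`K = h³` — so it is not absorbed by the singleton branch of the hybrid design, contrary to the reading of memo val-np-p3 g16 §18.
Composing the two gives `not_tropicalCertificates`: `¬ TC(Kf)` for every `Kf` with `h ≤ Kf h ≤ h⁴` eventually — in particular
for `Kf = h+2, 3h, h², h³` (`not_tropicalCertificates_add_two`, `_three_mul`, `_sq`, `_cube`) — and, through
`Tropical.Stmt.tropicalCertificates_of_projectionHomes` (p697226), `not_projectionHomes`: `¬ PH(Kf)` likewise.

WHAT SURVIVES (memo val-np-p3 g19 §2): the typed node `FullJoin.Stmt.universalThresholdDesign` (UTD: SOME threshold design with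
`K ≤ h³` per `(h, r)` — the state count and the design may depend on `r`, and the design need not be flat), the registered nodes
#1 / #5 and every kernel arrow; what dies is «ONE flat design on `Kf(h)` states for all `r`», i.e. TC / PH / UTD-flat(Kf) for every
`Kf ≤ h⁴`. The seat's census (kit j326713 / j326834) shows the same death numerically at `h = 13, 14, 15` for DOWN-SET rows
(`𝒰 = B₅([h])`, `K ∈ [25, 48]` at `h = 14`), by a different, colex-specific mechanism (3-fold sumset rank law).

WHAT THIS IS NOT: not a refutation of UTD, of node #1 `stub_universalJoinWide`, or of item 19717 (all OPEN); nothing on crux 14610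
or VP ≠ VNP.
-/

set_option linter.dupNamespace false

namespace Summit.ValiantsHypothesis.ValiantsHypothesis.Theorems.BarrierLever.HiddenStates

open Finset

noncomputable section

namespace Tropical

/-- **TC(Kf) is false for every polynomial budget.** If `h ≤ Kf h ≤ h⁴` for all large `h`, then
`Tropical.Stmt.tropicalCertificates Kf` fails: a certified family is `BallGood` (`ballGood_of_certified`), and
`FiveRank.not_ballGood_pow_four_hypothesis` (val-np-p4 g15, p577137) exhibits, for every `h ≥ 10¹⁰` and `K ∈ [h, h⁴]`, an injective
family that is not `BallGood h K r` (with `r ≈ K + 18h⁴`, inside the range `r > h³ + 1`). -/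
theorem not_tropicalCertificates (Kf : ℕ → ℕ) (h₀ : ℕ) (hK : ∀ h : ℕ, h₀ ≤ h → h ≤ Kf h ∧ Kf h ≤ h ^ 4) :
    ¬ Stmt.tropicalCertificates Kf := by
  rintro ⟨h₁, H⟩
  refine FiveRank.not_ballGood_pow_four_hypothesis (max h₀ h₁) Kf
    (fun h hh => hK h ((le_max_left _ _).trans hh)) ?_
  intro h hh r u hu
  exact ballGood_of_certified u
    (H h ((le_max_right _ _).trans hh) r (FullJoin.le_two_pow_of_injective u hu) u hu)

/-- **PH(Kf) is false for every polynomial budget** (PH ⇒ TC, `Stmt.tropicalCertificates_of_projectionHomes`, p697226). -/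
theorem not_projectionHomes (Kf : ℕ → ℕ) (h₀ : ℕ) (hK : ∀ h : ℕ, h₀ ≤ h → h ≤ Kf h ∧ Kf h ≤ h ^ 4) :
    ¬ Stmt.projectionHomes Kf :=
  fun H => not_tropicalCertificates Kf h₀ hK (Stmt.tropicalCertificates_of_projectionHomes Kf H)

/-- `¬ TC(h + 2)` — the «K = h + 2» form of the conjecture (memo val-np-p3 g18 §2). -/
theorem not_tropicalCertificates_add_two : ¬ Stmt.tropicalCertificates (fun h => h + 2) := by
  refine not_tropicalCertificates _ 2 fun h hh => ⟨by omega, ?_⟩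
  have h1 : h + 2 ≤ h * h := by nlinarith
  have h2 : h * h ≤ h ^ 4 := by
    calc h * h = h ^ 2 := by ring
      _ ≤ h ^ 4 := Nat.pow_le_pow_right (by omega) (by norm_num)
  exact h1.trans h2

/-- `¬ TC(3h)` — the «K = 3h» working form of the hybrid design (card v9h). -/
theorem not_tropicalCertificates_three_mul : ¬ Stmt.tropicalCertificates (fun h => 3 * h) := by
  refine not_tropicalCertificates _ 3 fun h hh => ⟨by omega, ?_⟩
  have h1 : 3 * h ≤ h * h := by nlinarith
  have h2 : h * h ≤ h ^ 4 := by
    calc h * h = h ^ 2 := by ring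
      _ ≤ h ^ 4 := Nat.pow_le_pow_right (by omega) (by norm_num)
  exact h1.trans h2

/-- `¬ TC(h²)` — the original «UTD-flat(K = h²)» budget (memo val-np-p3 g16 §16). -/
theorem not_tropicalCertificates_sq : ¬ Stmt.tropicalCertificates (fun h => h * h) := by
  refine not_tropicalCertificates _ 1 fun h hh => ⟨by nlinarith, ?_⟩
  calc h * h = h ^ 2 := by ring
    _ ≤ h ^ 4 := Nat.pow_le_pow_right (by omega) (by norm_num)

/-- `¬ TC(h³)` — the largest budget the one-cube door `partitionMinor_hit_of_fullJoin_mem` allows. -/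
theorem not_tropicalCertificates_cube : ¬ Stmt.tropicalCertificates (fun h => h * h * h) := by
  refine not_tropicalCertificates _ 1 fun h hh => ⟨by nlinarith, ?_⟩
  calc h * h * h = h ^ 3 := by ring
    _ ≤ h ^ 4 := Nat.pow_le_pow_right (by omega) (by norm_num)

/-- `¬ PH(h + 2)` and `¬ PH(3h)` — the forms whose censuses (h = 5, 6) motivated the conjecture (memo val-np-p3 g18 §2c). -/
theorem not_projectionHomes_add_two : ¬ Stmt.projectionHomes (fun h => h + 2) :=
  fun H => not_tropicalCertificates_add_two (Stmt.tropicalCertificates_of_projectionHomes _ H)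

/-- `¬ PH(3h)`. -/
theorem not_projectionHomes_three_mul : ¬ Stmt.projectionHomes (fun h => 3 * h) :=
  fun H => not_tropicalCertificates_three_mul (Stmt.tropicalCertificates_of_projectionHomes _ H)

/-- **The flat design is dead for DOWN-SETS too.** For every `h ≥ 10¹⁰` and every state count `K ∈ [h, h⁴]` there is an injective
row family whose range is a LOWER SET (a down-set of subsets of `Fin h` — the only families item 19717 needs, `DownCompression`) which
is not `BallGood h K r`: otherwise `LowerToAll.good_of_lower_onePiece` (val-np-p6, «lower sets suffice for every design») would make
FiveRank's 5-uniform witness `BallGood`. So «UTD-flat(K) for lower row families» fails at some `r ≈ K + 18h⁴ > h³ + 1` as well. -/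
theorem exists_lower_not_ballGood (h K : ℕ) (hh : 10 ^ 10 ≤ h) (hKlo : h ≤ K) (hKhi : K ≤ h ^ 4) :
    ∃ (r : ℕ) (v : Fin r → Finset (Fin h)), Function.Injective v ∧ IsLowerSet (Set.range v) ∧ ¬ BallGood h K r v := by
  classical
  obtain ⟨r, u, hu, hbad⟩ := FiveRank.exists_not_ballGood h K hh hKlo hKhi
  by_contra hcon
  push Not at hcon
  apply hbad
  intro e he hthr
  refine LowerToAll.good_of_lower_onePiece e (fun v hv hl => ?_) u hu
  exact hcon r v hv hl e he hthr

end Tropical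

end

end Summit.ValiantsHypothesis.ValiantsHypothesis.Theorems.BarrierLever.HiddenStates
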